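import Mathlib.Probability.Distributions.Gaussian.Real
import HarnessLib

/-!
# The rounded Gaussian: box probabilities of `round(2ᵇ g)`, `g ∼ 𝒩(0, 1/2)`

Topic `Probability/Distributions`. One real coordinate of a standard complex Gaussian has law
`𝒩(0, 1/2)` (density `π^{-1/2} e^{-x²}`); rounded to `b` bits it lives on the grid `2^{-b} ℤ`, and
`gaussBox b j = Pr[round(2ᵇ g) = j]` is the mass of the grid point `j` — the law of one coordinate of
an entry of the rounded Gaussian matrix `roundMatrix b X` handed to a `|GPE|²` solver
(Aaronson–Arkhipov 2013, Problem 1.2; `Literature.Computability.Cryptography.roundDyadic`). Written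
for the discharge of AA13 Thm. 1.3
(`Literature.Computability.QuantumComplexity.gpeSolvableInFBPPRel_NPRel_of_approxBosonSamplingOracle`),
whose hiding analysis compares this law with the law of the coin-driven decoy sampler
(`PseudoGaussianSampler.lean`) pointwise from above. Proved here, Mathlib only:

* `setOf_round_eq` — the rounding box `{x | round(2ᵇ x) = j} = [(j-½)2^{-b}, (j+½)2^{-b})`;
* `gaussianPDFReal_zero_half` — the density of `𝒩(0, 1/2)` is `π^{-1/2} e^{-x²}`;
* **`gaussBox_le`** — `gaussBox b j ≤ (h/√π) e^{-h²(j² - |j|)}`, `h = 2^{-b}` (length of the box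
  times the supremum of the density on it: on the box `x² ≥ h²(|j| - ½)² ≥ h²(j² - |j|)`).

## References

* S. Aaronson, A. Arkhipov, *The computational complexity of linear optics*, Theory of Computing 9
  (2013) 143–252, Problem 1.2 (p. 152) and §2 (p. 161: inputs rounded to `poly(n)` bits).
-/

namespace Literature.Probability.Distributions

open MeasureTheory ProbabilityTheory Real Set
open scoped NNReal

/-- The mass the rounded Gaussian gives to the grid point `j`:
`ℓ_b(j) = Pr[round(2ᵇ g) = j]`, `g ∼ 𝒩(0, 1/2)` (the law of one real coordinate of a standard
complex Gaussian rounded to `b` bits, as in `roundDyadic`). [folklore] -/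
noncomputable def gaussBox (b : ℕ) (j : ℤ) : ℝ :=
  (gaussianReal 0 (1 / 2 : ℝ≥0)).real {x : ℝ | round ((2 : ℝ) ^ b * x) = j}

/-- The rounding box: `round(2ᵇ x) = j ↔ x ∈ [(j - ½)/2ᵇ, (j + ½)/2ᵇ)`. [folklore] -/
theorem setOf_round_eq (b : ℕ) (j : ℤ) :
    {x : ℝ | round ((2 : ℝ) ^ b * x) = j} =
      Ico (((j : ℝ) - 1 / 2) * ((2 : ℝ) ^ b)⁻¹) (((j : ℝ) + 1 / 2) * ((2 : ℝ) ^ b)⁻¹) := by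
  have hN : (0 : ℝ) < (2 : ℝ) ^ b := by positivity
  ext x
  simp only [mem_setOf_eq, mem_Ico]
  rw [round_eq, Int.floor_eq_iff]
  constructor
  · rintro ⟨h1, h2⟩
    constructor
    · rw [← div_eq_mul_inv, div_le_iff₀ hN]; linarith
    · rw [← div_eq_mul_inv, lt_div_iff₀ hN]; linarith
  · rintro ⟨h1, h2⟩
    rw [← div_eq_mul_inv, div_le_iff₀ hN] at h1
    rw [← div_eq_mul_inv, lt_div_iff₀ hN] at h2
    constructor <;> linarith

/-- The box is measurable. [folklore] -/
theorem measurableSet_round_eq (b : ℕ) (j : ℤ) :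
    MeasurableSet {x : ℝ | round ((2 : ℝ) ^ b * x) = j} := by
  rw [setOf_round_eq]; exact measurableSet_Ico

/-- `ℓ_b(j) ≥ 0`. [folklore] -/
theorem gaussBox_nonneg (b : ℕ) (j : ℤ) : 0 ≤ gaussBox b j := measureReal_nonneg

/-- The density of `𝒩(0, 1/2)` is `π^{-1/2} e^{-x²}`. [folklore] -/
theorem gaussianPDFReal_zero_half (x : ℝ) :
    gaussianPDFReal 0 (1 / 2 : ℝ≥0) x = (√π)⁻¹ * exp (-x ^ 2) := by
  rw [gaussianPDFReal_def]
  simp only [NNReal.coe_div, NNReal.coe_one, NNReal.coe_ofNat, sub_zero]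
  congr 1
  · congr 1
    congr 1
    ring
  · congr 1
    field_simp

/-- **Box probabilities are dominated by the density at the near end of the box**:
`ℓ_b(j) ≤ (h/√π) e^{-h²(j² - |j|)}`, `h = 2^{-b}` (the box has length `h`, and on it
`x² ≥ h²(|j| - ½)² ≥ h²(j² - |j|)`). [folklore] -/
theorem gaussBox_le (b : ℕ) (j : ℤ) :
    gaussBox b j ≤ ((2 : ℝ) ^ b)⁻¹ / √π * exp (-(((2 : ℝ) ^ b)⁻¹ ^ 2 * ((j : ℝ) ^ 2 - |(j : ℝ)|))) := by
  set h : ℝ := ((2 : ℝ) ^ b)⁻¹ with hh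
  have hN : (0 : ℝ) < (2 : ℝ) ^ b := by positivity
  have hpos : 0 < h := by rw [hh]; positivity
  have hv : (1 / 2 : ℝ≥0) ≠ 0 := by norm_num
  unfold gaussBox
  rw [measureReal_def, gaussianReal_apply_eq_integral 0 hv, setOf_round_eq,
    ENNReal.toReal_ofReal (setIntegral_nonneg measurableSet_Ico fun x _ => gaussianPDFReal_nonneg _ _ _)]
  -- bound the integrand on the box
  set C : ℝ := (√π)⁻¹ * exp (-(h ^ 2 * ((j : ℝ) ^ 2 - |(j : ℝ)|))) with hC
  have hbound : ∀ x ∈ Ico (((j : ℝ) - 1 / 2) * h) (((j : ℝ) + 1 / 2) * h),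
      ‖gaussianPDFReal 0 (1 / 2 : ℝ≥0) x‖ ≤ C := by
    intro x hx
    rw [Real.norm_of_nonneg (gaussianPDFReal_nonneg _ _ _), gaussianPDFReal_zero_half, hC]
    refine mul_le_mul_of_nonneg_left ?_ (by positivity)
    rw [exp_le_exp, neg_le_neg_iff]
    -- `h²(j² - |j|) ≤ x²`
    obtain ⟨hx1, hx2⟩ := hx
    rcases lt_trichotomy j 0 with hj | hj | hj
    · have hjR : (j : ℝ) + 1 ≤ 0 := by exact_mod_cast Int.lt_iff_add_one_le.1 hj
      rw [abs_of_neg (by linarith : (j : ℝ) < 0)]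
      have hd : 0 ≤ -(((j : ℝ) + 1 / 2) * h) := by nlinarith
      have hnx : -(((j : ℝ) + 1 / 2) * h) ≤ -x := by linarith
      have hsq : (-(((j : ℝ) + 1 / 2) * h)) ^ 2 ≤ (-x) ^ 2 := pow_le_pow_left₀ hd hnx 2
      rw [neg_sq, neg_sq] at hsq
      have hdiff : h ^ 2 * ((j : ℝ) ^ 2 - -(j : ℝ)) ≤ (((j : ℝ) + 1 / 2) * h) ^ 2 := by
        nlinarith [sq_nonneg h]
      exact hdiff.trans hsq
    · subst hj
      have h0 : (0 : ℝ) ≤ x ^ 2 := sq_nonneg x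
      simpa using h0
    · have hjR : (1 : ℝ) ≤ j := by exact_mod_cast hj
      rw [abs_of_pos (by linarith : (0 : ℝ) < j)]
      have hd : 0 ≤ ((j : ℝ) - 1 / 2) * h := by nlinarith
      have hsq : (((j : ℝ) - 1 / 2) * h) ^ 2 ≤ x ^ 2 := pow_le_pow_left₀ hd hx1 2
      have hdiff : h ^ 2 * ((j : ℝ) ^ 2 - (j : ℝ)) ≤ (((j : ℝ) - 1 / 2) * h) ^ 2 := by
        nlinarith [sq_nonneg h]
      exact hdiff.trans hsq
  have hvol : volume (Ico (((j : ℝ) - 1 / 2) * h) (((j : ℝ) + 1 / 2) * h)) < ⊤ := by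
    rw [Real.volume_Ico]; exact ENNReal.ofReal_lt_top
  have hint := norm_setIntegral_le_of_norm_le_const hvol hbound
  rw [measureReal_def, Real.volume_Ico, ENNReal.toReal_ofReal (by nlinarith)] at hint
  have hlen : ((j : ℝ) + 1 / 2) * h - ((j : ℝ) - 1 / 2) * h = h := by ring
  rw [hlen] at hint
  calc ∫ x in Ico (((j : ℝ) - 1 / 2) * h) (((j : ℝ) + 1 / 2) * h), gaussianPDFReal 0 (1 / 2 : ℝ≥0) x
      ≤ ‖∫ x in Ico (((j : ℝ) - 1 / 2) * h) (((j : ℝ) + 1 / 2) * h), gaussianPDFReal 0 (1 / 2 : ℝ≥0) x‖ :=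
        le_norm_self _
    _ ≤ C * h := hint
    _ = h / √π * exp (-(h ^ 2 * ((j : ℝ) ^ 2 - |(j : ℝ)|))) := by rw [hC]; ring

end Literature.Probability.Distributions
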